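import Summits.QuantumFields.QCD.Theorems.QuarksAsStableActionStableActionBridgeWilsonTransferForm
import Summits.QuantumFields.QCD.Theorems.QuarksAsStableActionStableActionBridgeProjKroneckerDet

/-!
# The determinant of a Wilson chain block: `det E_t = det(w′_{t−1})² · det(B_t)²`
(helper for crux stmt-QuantumFields-9737 `QuarksAsStableAction.StableActionBridge`, line `Sketch`;
stub `det_wilson_chainBlock`)

In Lüscher's transfer-matrix form of the `r = 1` Wilson fermion determinant,
`det D_W = (∏_t det E_t) · det (1 − ∏_t M_t W_t)` (`wilson_det_transfer_form`), the chain blocks of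
the time-slice reduction are `E_t = A_t P⁻ − P⁺ W′_{t−1}` with `A_t` the Wilson slice operator,
`P± = ½ (1 ± γ₀)` the Wilson time projections (on spin) and `W′_s = w′_s ⊗ 1_spin` the inverse
temporal transporters of slice `s` (`w′_s` the site-block-diagonal colour matrix of the
`ρ(U((s,x),0)⁻¹)`).  This file evaluates the prefactor:

  `det E_t = det(w′_{t−1})² · det(B_t)²`,

where `B_t = (m + 4) − ½ Σ_j (H_j + H_j⁻)` is the spin-blind part of `A_t` (`B̂_t = B_t ⊗ 1_spin`).

Proof.  With `C_t = A_t − B̂_t` (so `P⁻ C_t P⁻ = 0`) and the forward transporter `W_{t−1}`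
(`W′_{t−1} W_{t−1} = 1`), the chain block factorises as
`E_t = (B̂_t P⁻ − P⁺ W′_{t−1}) · (1 − W_{t−1} P⁺ C_t P⁻)`
(`ChainBlockDet.chainBlock_eq_mul`, pure projection algebra).  The second factor is unipotent:
by the Weinstein–Aronszajn identity `det (1 − X P⁻) = det (1 − P⁻ X)` and
`P⁻ W P⁺ = W P⁻ P⁺ = 0` its determinant is `1`.  The first factor is, in Kronecker form on
`(site × colour) × spin`, `B_t ⊗ P⁻ − w′ ⊗ P⁺ = (−w′) ⊗ P⁺ + B_t ⊗ P⁻`, whose determinant is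
`det(−w′)² det(B_t)² = det(w′)² det(B_t)²` by the conjugation `H P± H⁻¹ = Q±` to coordinate
projections (`ProjKroneckerDet.det_kronecker_conj_eq`, `ProjKroneckerDet.det_kronecker_diag`).
No unitarity of `ρ` and no condition on the mass are needed.  The monomial normalisation reuses
`DressedTransfer.mul_mul_eq` / `mul_mul_comm`, the sign bookkeeping `WilsonTransfer.neg_kronecker`.
[cite: Luscher1977, pp. 283–292] (prose: Smit, *Introduction to Quantum Fields on a Lattice*,
§6.5).  Pure theorem file (no definitions).
-/

noncomputable section

namespace Summit.QuantumFields.QCD.Cruxes.StableActionBridge.Sketch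

open scoped ComplexOrder Kronecker
open Literature.MathematicalPhysics.QuantumFieldTheory Literature.MathematicalPhysics.QuantumLattice
open Literature.Probability.LatticeModels (TorusSite)

namespace ChainBlockDet

open Matrix

/-! ### Projection algebra: the factorisation of the chain block -/

section Algebra

variable {n : Type*} [Fintype n] [DecidableEq n]

/-- **Factorisation of the chain block.**  For complementary mutually annihilating projections
`Pp`, `Pm`, a slice operator `A` with spin-blind part `Bh` (`Pm A Pm = Bh Pm`, `Bh` commuting with
`Pm`) and transporters `W`, `W'` commuting with `Pp` and such that `W' W = 1`:
`A Pm − Pp W' = (Bh Pm − Pp W') (1 − W Pp (A − Bh) Pm)`. -/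
theorem chainBlock_eq_mul {Pp Pm A Bh W W' : Matrix n n ℂ} (h1 : Pp + Pm = 1)
    (hPP : Pp * Pp = Pp) (hPQ : Pp * Pm = 0) (hQP : Pm * Pp = 0) (hA : Pm * A * Pm = Bh * Pm)
    (hBQ : Bh * Pm = Pm * Bh) (hWP : W * Pp = Pp * W) (hW'P : W' * Pp = Pp * W')
    (hW'W : W' * W = 1) :
    A * Pm - Pp * W' = (Bh * Pm - Pp * W') * (1 - W * Pp * (A - Bh) * Pm) := by
  have hA' : Pm * (A * Pm) = Pm * Bh := by rw [← Matrix.mul_assoc, hA, hBQ]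
  calc A * Pm - Pp * W' = (Pp + Pm) * (A * Pm) - Pp * W' := by rw [h1, Matrix.one_mul]
    _ = (Bh * Pm - Pp * W') * (1 - W * Pp * (A - Bh) * Pm) := by
      -- step 1: distribute into right-associated monomials
      simp only [Matrix.add_mul, Matrix.mul_sub, Matrix.sub_mul, Matrix.mul_one, Matrix.mul_assoc]
      -- step 2: normalise each monomial (projections move left through `W`, `W'`; repeated
      -- projections merge; `Pp Pm = Pm Pp = 0` kill; `W' W = 1`; `Pm A Pm = Pm Bh`)
      simp only [hA', hBQ, DressedTransfer.mul_mul_eq hPP, DressedTransfer.mul_mul_eq hPQ,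
        DressedTransfer.mul_mul_eq hQP, DressedTransfer.mul_mul_eq hW'W,
        DressedTransfer.mul_mul_comm hWP, DressedTransfer.mul_mul_comm hW'P, Matrix.mul_zero,
        Matrix.zero_mul, Matrix.one_mul, sub_zero, zero_sub]
      abel

/-- **The unipotent factor.**  If `W Pm = Pm W` and `Pm Pp = 0` then
`det (1 − W Pp C Pm) = 1` (Weinstein–Aronszajn: `det (1 − X Pm) = det (1 − Pm X)` and
`Pm W Pp = W Pm Pp = 0`). -/
theorem det_one_sub_eq_one {Pp Pm C W : Matrix n n ℂ} (hQP : Pm * Pp = 0)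
    (hWQ : W * Pm = Pm * W) : (1 - W * Pp * C * Pm).det = 1 := by
  rw [Matrix.det_one_sub_mul_comm, ← Matrix.mul_assoc, ← Matrix.mul_assoc, ← hWQ,
    Matrix.mul_assoc W Pm Pp, hQP, Matrix.mul_zero, Matrix.zero_mul, sub_zero, Matrix.det_one]

end Algebra

/-! ### The Kronecker factor `B ⊗ P⁻ − w′ ⊗ P⁺` -/

section KroneckerForm

variable {X Y : Type*} [Fintype X] [DecidableEq X] [Fintype Y] [DecidableEq Y]

/-- `det (−M)² = det (M)²`, since `(−M)(−M) = M M`. -/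
theorem det_neg_sq (M : Matrix (X × Y) (X × Y) ℂ) : (-M).det ^ 2 = M.det ^ 2 := by
  rw [sq, sq, ← Matrix.det_mul, neg_mul_neg, Matrix.det_mul]

/-- **Determinant of the Kronecker factor.**  With `R` the reassociation along `Equiv.prodAssoc`,
`det (R (B ⊗ 1) R (1 ⊗ P⁻) − R (1 ⊗ P⁺) R (w′ ⊗ 1)) = det (w′)² det (B)²`: the matrix is
`(−w′) ⊗ P⁺ + B ⊗ P⁻`, conjugate by `1 ⊗ H` to the block-diagonal `(−w′) ⊗ Q⁺ + B ⊗ Q⁻`. -/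
theorem det_spinDiag_projMinus_sub_projPlus_colour (B w' : Matrix (X × Y) (X × Y) ℂ) :
    (Matrix.reindexAlgEquiv ℂ ℂ (Equiv.prodAssoc X Y (Fin 4)) (B ⊗ₖ (1 : Matrix (Fin 4) (Fin 4) ℂ)) *
          Matrix.reindexAlgEquiv ℂ ℂ (Equiv.prodAssoc X Y (Fin 4))
            ((1 : Matrix (X × Y) (X × Y) ℂ) ⊗ₖ ((1 / 2 : ℂ) • (1 - euclideanGamma 0))) -
        Matrix.reindexAlgEquiv ℂ ℂ (Equiv.prodAssoc X Y (Fin 4))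
            ((1 : Matrix (X × Y) (X × Y) ℂ) ⊗ₖ ((1 / 2 : ℂ) • (1 + euclideanGamma 0))) *
          Matrix.reindexAlgEquiv ℂ ℂ (Equiv.prodAssoc X Y (Fin 4))
            (w' ⊗ₖ (1 : Matrix (Fin 4) (Fin 4) ℂ))).det =
      w'.det ^ 2 * B.det ^ 2 := by
  rw [← map_mul, ← map_mul, ← map_sub, Matrix.det_reindexAlgEquiv]
  simp only [← Matrix.mul_kronecker_mul, Matrix.mul_one, Matrix.one_mul]
  rw [sub_eq_neg_add, ← WilsonTransfer.neg_kronecker,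
    ProjKroneckerDet.det_kronecker_conj_eq _ _ ShiftSubstDet.spinH_mul_projPlus
      ShiftSubstDet.spinH_mul_projMinus ShiftSubstDet.spinH_mul_spinHinv,
    ProjKroneckerDet.det_kronecker_diag, det_neg_sq]

end KroneckerForm

end ChainBlockDet

/-- **Determinant of a Wilson chain block** (stub `det_wilson_chainBlock` of line `Sketch`):
in the time-slice reduction of the `r = 1` Wilson fermion determinant the chain block
`E_t = A_t P⁻ − P⁺ W′_{t−1}` of slice `t` has determinant `det(w′_{t−1})² · det(B_t)²`, where
`w′_s` is the site-block-diagonal colour matrix of the inverse temporal links of slice `s` and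
`B_t` the spin-blind slice operator.  No unitarity of `ρ` and no mass condition are needed.
[cite: Luscher1977, pp. 283–292] -/
theorem det_wilson_chainBlock :
    ∀ (Nc L : ℕ) [NeZero L] (G : Type) [Group G] (ρ : G →* Matrix (Fin Nc) (Fin Nc) ℂ) (U : GaugeConfig 4 L G) (m : ℝ) (t : ZMod L), let Pp : Matrix (TorusSite 3 L × Fin Nc × Fin 4) (TorusSite 3 L × Fin Nc × Fin 4) ℂ := Matrix.of fun a b => if a.1 = b.1 ∧ a.2.1 = b.2.1 then ((1 / 2 : ℂ) • (1 + euclideanGamma 0)) a.2.2 b.2.2 else 0; let Pm : Matrix (TorusSite 3 L × Fin Nc × Fin 4) (TorusSite 3 L × Fin Nc × Fin 4) ℂ := Matrix.of fun a b => if a.1 = b.1 ∧ a.2.1 = b.2.1 then ((1 / 2 : ℂ) • (1 - euclideanGamma 0)) a.2.2 b.2.2 else 0; let W' : ZMod L → Matrix (TorusSite 3 L × Fin Nc × Fin 4) (TorusSite 3 L × Fin Nc × Fin 4) ℂ := fun t => Matrix.of fun a b => if a.1 = b.1 ∧ a.2.2 = b.2.2 then ρ (U ((Fin.cons t a.1 :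 TorusSite 4 L), 0))⁻¹ a.2.1 b.2.1 else 0; let A : ZMod L → Matrix (TorusSite 3 L × Fin Nc × Fin 4) (TorusSite 3 L × Fin Nc × Fin 4) ℂ := fun t => Matrix.of fun a b => (if a = b then ((m + 4 * 1 : ℝ) : ℂ) else 0) - (1 / 2 : ℂ) * ∑ j : Fin 3, ((if b.1 = Literature.MathematicalPhysics.QuantumFieldTheory.Site.shift a.1 j then (((1 : ℝ) : ℂ) • (1 : Matrix (Fin 4) (Fin 4) ℂ) - euclideanGamma j.succ) a.2.2 b.2.2 * ρ (U ((Fin.cons t a.1 : TorusSite 4 L), j.succ)) a.2.1 b.2.1 else 0) + (if a.1 = Literature.MathematicalPhysics.QuantumFieldTheory.Site.shift b.1 j then (((1 : ℝ) : ℂ) • (1 : Matrix (Fin 4) (Fin 4) ℂ) + euclideanGamma j.succ) a.2.2 b.2.2 * ρ (U ((Fin.cons t b.1 : TorusSite 4 L), j.succ))⁻¹ a.2.1 b.2.1 else 0)); let B : ZMod L → Matrix (TorusSite 3 L × Fin Nc) (TorusSite 3 L × Fin Nc) ℂ := fun t => Matrix.of fun a b => (if a = b then ((m + 4 : ℝ)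 : ℂ) else 0) - (1 / 2 : ℂ) * ∑ j : Fin 3, ((if b.1 = Literature.MathematicalPhysics.QuantumFieldTheory.Site.shift a.1 j then ρ (U ((Fin.cons t a.1 : TorusSite 4 L), j.succ)) a.2 b.2 else 0) + (if a.1 = Literature.MathematicalPhysics.QuantumFieldTheory.Site.shift b.1 j then ρ (U ((Fin.cons t b.1 : TorusSite 4 L), j.succ))⁻¹ a.2 b.2 else 0)); let w' : ZMod L → Matrix (TorusSite 3 L × Fin Nc) (TorusSite 3 L × Fin Nc) ℂ := fun s => Matrix.of fun p q => if p.1 = q.1 then ρ (U ((Fin.cons s p.1 : TorusSite 4 L), 0))⁻¹ p.2 q.2 else 0; (A t * Pm - Pp * W' (t - 1)).det = (w' (t - 1)).det ^ 2 * (B t).det ^ 2 := by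
  intro Nc L _ G _ ρ U m t Pp Pm W' A B w'
  -- the forward transporter of slice `t - 1` and the spin lift `B̂_t = B_t ⊗ 1_spin`
  let W : Matrix (TorusSite 3 L × Fin Nc × Fin 4) (TorusSite 3 L × Fin Nc × Fin 4) ℂ :=
    Matrix.of fun a b => if a.1 = b.1 ∧ a.2.2 = b.2.2 then
      ρ (U ((Fin.cons (t - 1) a.1 : TorusSite 4 L), 0)) a.2.1 b.2.1 else 0
  let Bh : Matrix (TorusSite 3 L × Fin Nc × Fin 4) (TorusSite 3 L × Fin Nc × Fin 4) ℂ :=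
    Matrix.of fun a b => if a.2.2 = b.2.2 then B t (a.1, a.2.1) (b.1, b.2.1) else 0
  -- projection algebra
  have h1 : Pp + Pm = 1 := liftProjPlus_add_liftProjMinus (TorusSite 3 L) Nc
  have hPQ : Pp * Pm = 0 := liftProjPlus_mul_liftProjMinus (TorusSite 3 L) Nc
  have hQP : Pm * Pp = 0 := liftProjMinus_mul_liftProjPlus (TorusSite 3 L) Nc
  have hPP : Pp * Pp = Pp := WilsonTransfer.mul_self_of_add_eq_one h1 hPQ
  -- spin structure of the slice operator (slice `t`) and of the transporters (slice `t - 1`)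
  have hspin := wilsonSlice_spin_structure Nc L G ρ U m t
  have hspin' := wilsonSlice_spin_structure Nc L G ρ U m (t - 1)
  have hA : Pm * A t * Pm = Bh * Pm := hspin.1
  have hBQ : Bh * Pm = Pm * Bh := hspin.2.1
  have hWP : W * Pp = Pp * W := hspin'.2.2.2.2.1
  have hWQ : W * Pm = Pm * W := hspin'.2.2.2.2.2.1
  have hW'P : W' (t - 1) * Pp = Pp * W' (t - 1) := hspin'.2.2.2.2.2.2.1
  have hW'W : W' (t - 1) * W = 1 := hspin'.2.2.2.2.2.2.2.2
  -- the factorisation `E_t = (B̂_t P⁻ − P⁺ W′_{t−1}) (1 − W_{t−1} P⁺ C_t P⁻)`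
  have hfac : A t * Pm - Pp * W' (t - 1) =
      (Bh * Pm - Pp * W' (t - 1)) * (1 - W * Pp * (A t - Bh) * Pm) :=
    ChainBlockDet.chainBlock_eq_mul h1 hPP hPQ hQP hA hBQ hWP hW'P hW'W
  have hunip : (1 - W * Pp * (A t - Bh) * Pm).det = 1 := ChainBlockDet.det_one_sub_eq_one hQP hWQ
  -- Kronecker forms of `Pp`, `Pm`, `B̂_t`, `W′_{t−1}`
  have hPp : Pp = Matrix.reindexAlgEquiv ℂ ℂ (Equiv.prodAssoc (TorusSite 3 L) (Fin Nc) (Fin 4))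
      ((1 : Matrix (TorusSite 3 L × Fin Nc) (TorusSite 3 L × Fin Nc) ℂ) ⊗ₖ
        ((1 / 2 : ℂ) • (1 + euclideanGamma 0))) :=
    SliceSpin.of_spin_eq ((1 / 2 : ℂ) • (1 + euclideanGamma 0))
  have hPm : Pm = Matrix.reindexAlgEquiv ℂ ℂ (Equiv.prodAssoc (TorusSite 3 L) (Fin Nc) (Fin 4))
      ((1 : Matrix (TorusSite 3 L × Fin Nc) (TorusSite 3 L × Fin Nc) ℂ) ⊗ₖ
        ((1 / 2 : ℂ) • (1 - euclideanGamma 0))) :=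
    SliceSpin.of_spin_eq ((1 / 2 : ℂ) • (1 - euclideanGamma 0))
  have hBh : Bh = Matrix.reindexAlgEquiv ℂ ℂ (Equiv.prodAssoc (TorusSite 3 L) (Fin Nc) (Fin 4))
      (B t ⊗ₖ (1 : Matrix (Fin 4) (Fin 4) ℂ)) :=
    SliceSpin.of_spinDiag_eq (B t)
  have hW' : W' (t - 1) = Matrix.reindexAlgEquiv ℂ ℂ (Equiv.prodAssoc (TorusSite 3 L) (Fin Nc) (Fin 4))
      (w' (t - 1) ⊗ₖ (1 : Matrix (Fin 4) (Fin 4) ℂ)) :=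
    SliceSpin.of_colour_eq fun x => ρ (U ((Fin.cons (t - 1) x : TorusSite 4 L), 0))⁻¹
  have hker : (Bh * Pm - Pp * W' (t - 1)).det = (w' (t - 1)).det ^ 2 * (B t).det ^ 2 := by
    rw [hBh, hPm, hPp, hW']
    exact ChainBlockDet.det_spinDiag_projMinus_sub_projPlus_colour (B t) (w' (t - 1))
  rw [hfac, Matrix.det_mul, hunip, mul_one, hker]

end Summit.QuantumFields.QCD.Cruxes.StableActionBridge.Sketch

end
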